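import Literature.Probability.Percolation.SlabCircuitGlueHighProb
import Literature.Probability.Percolation.SlabRSWHalfSide
import HarnessLib

/-!
# Newman–Tassion–Wu 2017, Theorem 3.17 (arXiv) / 3.19 (CPAM) — gluing a far side to the minimal circuit of
# an annulus, high-probability regime (the step "P[B ⟷^R R(R)] ≥ h₀(1-δ)" of the RSW high-probability theorem)

Topic: `Literature/Probability/Percolation`.  Eighth file of the circuit gluing layer: its second application,
the building block of (H317).  NTW (CPAM p. 31): "the existence of an open circuit in `A_{n,c₁n}(z)` …
implies that there is an open path from `A` to `B` inside `S` … Using (3.33) and (3.34), and an adaptation of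
the Theorem 3.8 gluing lemma … one has `P[B ⟷^R R(R)] ≥ h₀(1-δ)`".  With the circuit gluing lemma the slit
domain is not needed: a `CircGlue` datum with CONSTANT source (a planar set `Csupp ⊆ W` off `B_n(c)`, e.g. the
far side of the rectangle) is glued to the minimal circuit `Γ_min` of `A_{m,n}(c)` as soon as some open path
inside the world runs from inside `B_m(c)` to `Csupp` (it passes through a column of `Γ_min`,
`exists_sameColumn_of_isOSAP`).

* `CircGlue.ofConst` — the datum with a constant source.
* `CircGlue.evCol_ofConst_of_cross` — circuit + open path from `B_m(c)` to `Csupp` inside `W` ⟹ `evCol`.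
* **`sideToCircuit_highProb`** — ∀ k ε η ∃ δ: for every such datum and `p ∈ [ε,1-ε]`, if
  `P[𝒜_{m,n}(c)] ≥ 1-δ` and `P[X ⟷^S Csupp] ≥ 1-δ` (`X ⊆ B_m(c)`, `S ⊆ W`), then `P[Csupp ⟷^{W̄} Γ_min] ≥ 1-η`.

## Sources

* C. M. Newman, V. Tassion, W. Wu, *Critical percolation and the minimal spanning tree in slabs*,
  Comm. Pure Appl. Math. 70 (2017) = arXiv:1512.09107: Theorem 3.17 (arXiv) = 3.19 (CPAM), proof, (3.33)–(3.34)
  and the two gluings of Fig. 3.6; Theorem 3.8 [NewmanTassionWu2017].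
-/

noncomputable section

namespace Literature.Probability.Percolation

open MeasureTheory LatticeModels SimpleGraph

namespace NTW17

namespace CircGlue

variable {k : ℕ}

/-- **The circuit-gluing datum with a constant source** `C̄supp` (`Csupp ⊆ W` off `B_n(c)`).
[cite: NewmanTassionWu2017, Theorem 3.17 (proof: gluing the circuit to the right side R(R))] -/
def ofConst (k : ℕ) (c : ℤ × ℤ) (m n : ℕ) (W Csupp : Set (ℤ × ℤ)) (hWfin : W.Finite) (hAW : annulus c m n ⊆ W)
    (hCW : Csupp ⊆ W) (hCfar : Disjoint Csupp (sqBox c n)) : CircGlue k where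
  c := c
  m := m
  n := n
  W := W
  Csupp := Csupp
  src := fun _ => slabLift k Csupp
  hWfin := hWfin
  hAW := hAW
  hCW := hCW
  hCfar := hCfar
  hsrc := fun _ => subset_rfl
  hsrc_loc := fun _ _ _ => rfl

variable {c : ℤ × ℤ} {m n : ℕ} {W Csupp : Set (ℤ × ℤ)} {hWfin : W.Finite} {hAW : annulus c m n ⊆ W}
  {hCW : Csupp ⊆ W} {hCfar : Disjoint Csupp (sqBox c n)}

/-- The glued event of the constant-source datum is `Csupp ⟷^{W̄} Γ_min`. [cite: NewmanTassionWu2017, Theorem 3.17 (proof)] -/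
theorem mem_evGlued_ofConst_iff {ω : BondConfig (slab 3 k)} :
    ω ∈ (ofConst k c m n W Csupp hWfin hAW hCW hCfar).evGlued ↔
      ∃ c₀ ∈ slabLift k Csupp, ∃ g ∈ minCircuit k ω c m n, ω ∈ openConnIn (slabLift k W) c₀ g := Iff.rfl

/-- **A circuit and an open path from inside `B_m(c)` to the source inside the world give `evCol`.**
[cite: NewmanTassionWu2017, Theorem 3.17 (proof: "the existence of an open circuit … implies that there is an open path from A to B"), with Theorem 3.8] -/
theorem evCol_ofConst_of_cross {ω : BondConfig (slab 3 k)} (hω : ω ⊆ (slabGraph 3 k).edgeSet)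
    (hH : ω ∈ circuitAround k c m n) {S X : Set (ℤ × ℤ)} (hS : S ⊆ W) (hX : X ⊆ sqBox c m)
    (hcross : ω ∈ slabConn k S X Csupp) : ω ∈ (ofConst k c m n W Csupp hWfin hAW hCW hCfar).evCol := by
  obtain ⟨⟨hc₁, hs₁⟩, -⟩ := minCircuit_spec hH
  obtain ⟨L, hL⟩ := (mem_slabConn_iff_exists_isOSAP ω _ _ _).1 hcross
  have hhead : planar k (L.head hL.ne_nil) ∈ sqBox c m := by
    have := hL.head_mem hL.ne_nil; rw [mem_slabLift_iff] at this; exact hX this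
  have hlastC : L.getLast hL.ne_nil ∈ slabLift k Csupp := hL.last_mem hL.ne_nil
  have hlast : planar k (L.getLast hL.ne_nil) ∉ sqBox c n := by
    rw [mem_slabLift_iff] at hlastC
    exact fun h => Set.disjoint_left.1 hCfar hlastC h
  obtain ⟨w, hwL, v, hv, hwv⟩ := exists_sameColumn_of_isOSAP hω hc₁ hs₁ hL hhead hlast
  have hconn : ω ∈ openConnIn (slabLift k W) (L.getLast hL.ne_nil) w :=
    openConnIn_mono (slabLift_mono k hS) _ _
      (openConnIn_reverse (SlabCriticality.openConnIn_trans (openConnIn_reverse (hL.openConnIn_of_mem hwL))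
        (hL.openConnIn_of_mem (List.getLast_mem hL.ne_nil))))
  exact ⟨L.getLast hL.ne_nil, hlastC, w, hconn, near_zero_iff.2 ⟨v, hv, hwv.symm⟩⟩

end CircGlue

/-- **Gluing a far set to the minimal circuit, high-probability regime.**  For every `k`, `ε > 0`, `η > 0`
there is `δ > 0` such that: for every annulus `A_{m,n}(c)`, finite world `W ⊇ A_{m,n}(c)`, planar set
`Csupp ⊆ W` disjoint from `B_n(c)`, sets `S ⊆ W`, `X ⊆ B_m(c)`, and `p ∈ [ε, 1-ε]`: if `P_p[𝒜_{m,n}(c)] ≥ 1-δ`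
and `P_p[X ⟷^S Csupp] ≥ 1-δ`, then `P_p[C̄supp ⟷^{W̄} Γ_min(A_{m,n}(c))] ≥ 1-η`.
[cite: NewmanTassionWu2017, Theorem 3.17 (proof: P[B ⟷^R R(R)] ≥ h₀(1-δ) via the gluing lemma), with Theorem 3.8] -/
theorem sideToCircuit_highProb (k : ℕ) {ε : ℝ} (hε : 0 < ε) {η : ℝ} (hη : 0 < η) :
    ∃ δ : ℝ, 0 < δ ∧ ∀ (c : ℤ × ℤ) (m n : ℕ) (W Csupp S X : Set (ℤ × ℤ)) (hWfin : W.Finite)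
      (hAW : annulus c m n ⊆ W) (hCW : Csupp ⊆ W) (hCfar : Disjoint Csupp (sqBox c n)), S ⊆ W → X ⊆ sqBox c m →
      ∀ p : unitInterval, ε ≤ (p : ℝ) → (p : ℝ) ≤ 1 - ε →
      1 - δ ≤ (bondPercolation (slabGraph 3 k) p).real (circuitAround k c m n) →
      1 - δ ≤ (bondPercolation (slabGraph 3 k) p).real (slabConn k S X Csupp) →
      1 - η ≤ (bondPercolation (slabGraph 3 k) p).real
        (CircGlue.ofConst k c m n W Csupp hWfin hAW hCW hCfar).evGlued := by
  obtain ⟨δ, hδ, H⟩ := circuitGlue_highProb k hε hη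
  refine ⟨δ / 2, by positivity, fun c m n W Csupp S X hWfin hAW hCW hCfar hS hX p hpε hp1 hA hC => ?_⟩
  set P := bondPercolation (slabGraph 3 k) p with hP
  set D := CircGlue.ofConst k c m n W Csupp hWfin hAW hCW hCfar with hD
  refine H D p hpε hp1 ?_
  -- the column-contact event contains `𝒜 ∩ {X ⟷^S Csupp}` up to a null set
  have hfinS : S.Finite := hWfin.subset hS
  have hAm : MeasurableSet (circuitAround k c m n : Set (BondConfig (slab 3 k))) := measurableSet_circuitAround _ _ _
  have hCm : MeasurableSet (slabConn k S X Csupp) := measurableSet_slabConn_of_finite (k := k) hfinS _ _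
  have hae : ∀ᵐ ω ∂P, ω ∈ circuitAround k c m n ∩ slabConn k S X Csupp → ω ∈ D.evCol := by
    filter_upwards [ae_subset_edgeSet (slabGraph 3 k) p] with ω hω h
    exact CircGlue.evCol_ofConst_of_cross hω h.1 hS hX h.2
  have h3 : P.real (circuitAround k c m n ∩ slabConn k S X Csupp) ≤ P.real D.evCol := by
    simp only [measureReal_def]
    exact ENNReal.toReal_mono (measure_ne_top _ _) (measure_mono_ae hae)
  have hc1 : P.real (circuitAround k c m n)ᶜ ≤ δ / 2 := by rw [probReal_compl_eq_one_sub hAm]; linarith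
  have hc2 : P.real (slabConn k S X Csupp)ᶜ ≤ δ / 2 := by rw [probReal_compl_eq_one_sub hCm]; linarith
  have hcS : P.real (circuitAround k c m n ∩ slabConn k S X Csupp)ᶜ ≤ δ := by
    rw [Set.compl_inter]
    exact (measureReal_union_le _ _).trans (by linarith)
  have hSc := probReal_compl_eq_one_sub (μ := P) (hAm.inter hCm)
  linarith

end NTW17

end Literature.Probability.Percolation

end
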